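import Mathlib.Analysis.Calculus.Deriv.Inv
import Mathlib.Analysis.Calculus.Deriv.Mul
import Mathlib.Analysis.Calculus.Deriv.Pow
import Mathlib.Analysis.Calculus.Deriv.Comp
import Mathlib.MeasureTheory.Function.LocallyIntegrable
import Mathlib.MeasureTheory.Integral.Bochner.Set
import Mathlib.Order.Filter.AtTopBot.Archimedean
import Literature.Analysis.FluidPDE.VectorCalculus
import HarnessLib

/-!
# The one-loop coefficient `κ(W)` of an Euler–Leray skeleton (dilation drift under small viscosity)

Analysis/FluidPDE definition file (definitions + proved API; no named facts), answering the
definition request `defn-oneLoopKappa` of route `NavierStokesRegularity/MarginalReynoldsCreep`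
(layer-2 items `ModulationLaw`, `KappaNegative`; D2 of the route text). Its companion D1 is the
tree's `EulerLeraySkeleton.lean` (`IsEulerLeraySkeleton W P`, the dilation family
`eulerLerayDilate μ W = μ⁻¹ W(μ ·)` and its generator `hasDerivAt_eulerLerayDilate_one`); this
interface takes the profile `W : E → E` as a bare parameter and does not import it (see the design
notes).

## Background (Pomeau–Le Berre–Lehner 2018, §5)

In Leray's backward similarity variables `y = x/√(T−t)`, `s = −log(T−t)`,
`u(x,t) = (T−t)^{-1/2} V(y,s)`, the Navier–Stokes equations read
`∂ₛV + ½(V + y·∇V) + V·∇V + ∇P = ν ΔV`, `∇·V = 0` (PLBL §3, eq. (NS-Leray)), and dropping `ν ΔV`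
gives the **Euler–Leray equations** (PLBL §4, eq. (Euler-Leray1)). A steady solution `W` in Leray's
decay class is an **Euler–Leray skeleton** (`IsEulerLeraySkeleton W P`), and the steady equations
are invariant under the dilations `W_μ = μ⁻¹W(μ·)` (`IsEulerLeraySkeleton.eulerLerayDilate`).
Hence the **dilation mode** `W_d := ∂_μ|_{μ=1} W_μ = y·∇W − W` (`dilationMode`,
`hasDerivAt_dilation_dilationMode`) lies in the kernel
of the linearised similarity-Euler operator `L_W v = ½(v + y·∇v) + W·∇v + v·∇W + ∇q`
(Leray-projected; `linearisedSimilarityEuler` is its pressure-free part `L⁰_W`), together with the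
rotation modes `DW(y)[Ay] − A W(y)`, `Aᵀ = −A` (`infinitesimalRotation`; PLBL §5: "there is also a
continuous symmetry under rotations which is preserved by the viscosity term and so does not bring
any dynamics of the parameter `μ`").

PLBL §5 then turn on a small viscosity: with the ansatz `V = W_{μ(s)} + U_c`, `U_c = O(ν)`, the
correction solves (self2.5) `∂ₛW_μ + L_{W_μ} U_c = ν ΔW_μ`, and pairing with an element `Z = U†`
of the kernel of the adjoint operator, `L_W^* Z = 0`, in the `L²` pairing (self2.7)
`⟨U_e|U_f⟩ = ∫ U_e·U_f dR`, kills `U_c` and leaves the **solvability condition** (self2.6)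

  `dμ/dτ · ⟨Z | ∂_μ W_μ⟩ = ν ⟨Z | ΔW_μ⟩`,

"a dynamical equation for the dilation parameter `μ`": "the effect of a non vanishing viscosity
is to cause a drift of the solution of Euler–Leray equations in the space of the parameter `μ`".
At `μ = 1` this is `dμ/ds = ν · ρ(W)`, `ρ(W) := ⟨ΔW, Z⟩ / ⟨W_d, Z⟩` (`OneLoopData.dilationDrift`).

The route reads the same law through its **running coupling**, the local Reynolds number
`R(t) = (T−t)‖u(t)‖²_∞/ν = ‖V(s)‖²_∞/ν`, `ε = 1/R`: along `V ≈ W_{μ(s)}` one has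
`‖V‖_∞ = μ⁻¹‖W‖_∞`, so `R = ‖W‖²_∞/(ν μ²)`; scaling covariance of (self2.6)
(`Δ(W_μ) = μ² (ΔW)_μ`, `∂_μW_μ = μ⁻¹ (W_d)_μ`, `Z_μ = Z(μ·)`) gives `dμ/ds = ν μ³ ρ(W)` along the
whole family, hence `dR/ds = −2‖W‖²_∞ ρ(W) =: κ(W)` and `dε/ds = −κ(W) ε²`
(`hasDerivAt_reynolds_of_dilationDrift` is the calculus step
`μ' = νμ³ρ ⇒ (‖W‖²/(νμ²))' = −2‖W‖²ρ`). This is the requested normalisation of the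
**one-loop coefficient**

  `oneLoopKappa d = −2 ‖W‖²_∞ · ⟨ΔW, Z⟩ / ⟨y·∇W − W, Z⟩`

("`ε' = −κ(W) ε²` along a viscous orbit shadowing `W`"): `κ > 0` is linear creep `R ≈ κ s`
(route item `OneLoopCreep`), `κ < 0` the exit to Type I (`NoLinearCreep`/`KappaNegative` assert
`κ(W) < 0` for every admissible skeleton). It is invariant under `W ↦ W_λ` (the bare ratio `ρ`
scales like `λ²`, `‖W_λ‖²_∞` like `λ⁻²`) and under `Z ↦ c Z` (`oneLoopKappa_smul`).

## Contents

* `dilationMode W y = DW(y)[y] − W y` (with `hasDerivAt_dilation_dilationMode`: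
  `d/dμ|_{μ=1} μ⁻¹W(μy) = dilationMode W y`, the tree's `hasDerivAt_eulerLerayDilate_one` in this
  packaging), `infinitesimalRotation A W y = DW(y)[A y] − A (W y)`.
* `linearisedSimilarityEuler W v y = ½(v y + Dv(y)[y]) + Dv(y)[W y] + DW(y)[v y]` — `L⁰_W v`.
* `HasRadialPairing f g ℓ`, `radialPairing f g` — the pairing (self2.7) `∫ ⟪f, g⟫` as an
  **improper integral over centred balls** `lim_{ρ→∞} ∫_{‖y‖≤ρ} ⟪f y, g y⟫ dy` (see the design
  notes for why not the Lebesgue integral); `.of_integrable` (agrees with `∫` under absolute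
  convergence), `.unique`, `.radialPairing_eq`, `.smul_right`, `hasRadialPairing_zero_left/right`,
  `hasRadialPairing_of_forall_inner_eq_zero`.
* `OneLoopData W` — **the interface**: an adjoint zero mode `Z` DUAL TO THE DILATION MODE, i.e.
  `Z ∈ L¹_loc`, weakly divergence free (so that it annihilates the pressure gradients of `L_W`),
  `∫ ⟪L⁰_W v, Z⟫ = 0` for every divergence-free test field `v` (the weak form of `L_W^* Z = 0`),
  both pairings `⟨ΔW, Z⟩`, `⟨W_d, Z⟩` convergent with `⟨W_d, Z⟩ ≠ 0` (transversality to the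
  dilation mode), and `⟨infinitesimalRotation A W, Z⟩ = 0` for every skew `A` (duality: `Z`
  annihilates the other symmetry modes of the kernel). `OneLoopData.smul` rescales `Z`.
* `OneLoopData.dilationDrift d = ⟨ΔW, Z⟩/⟨W_d, Z⟩` (PLBL (self2.6) at `μ = 1`, per unit
  viscosity) and **`oneLoopKappa d = −2 (⨆ y, ‖W y‖)² · d.dilationDrift`**; `oneLoopKappa_smul`,
  `oneLoopKappa_congr_ae`, `oneLoopKappa_eq_of_ae_eq_smul` (uniqueness of `Z` up to scale a.e.
  ⇒ the same `κ`), `oneLoopKappa_neg_iff` / `oneLoopKappa_pos_iff` (for `W ≠ 0` bounded: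
  `κ < 0 ↔ 0 < ρ`), `hasDerivAt_reynolds_of_dilationDrift`, `hasDerivAt_reynolds_oneLoopKappa`.

## Design notes (what is and is not asserted)

* INTERFACE ONLY (the request: "existence/uniqueness of `Z` … filed SEPARATELY as a construction
  statement, never assumed in the interface"). `OneLoopData W` is DATA; whether it is inhabited
  for an admissible skeleton (Fredholmness of `L_W` in `⟨y⟩`-weighted spaces, a finite-dimensional
  adjoint kernel spanned by the modes dual to dilation and rotations) and whether `Z` is unique up
  to scale (so that `κ(W)` does not depend on `d`; cf. `oneLoopKappa_smul`) is analytic content of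
  the route, not asserted here. Nothing in this file assumes `W` solves anything: `W : E → E` is a
  parameter; its admissibility is the tree's `IsEulerLeraySkeleton W P`, which this file does not
  import (the interface is independent of the skeleton class; the bridges are one-liners for the
  consumer: `hasDerivAt_eulerLerayDilate_one` is `hasDerivAt_dilation_dilationMode` up to unfolding
  `eulerLerayDilate`, and `IsEulerLeraySkeleton.exists_forall_norm_le` supplies the `BddAbove`
  hypothesis of `oneLoopKappa_neg_iff`). `W_d = 0` exactly for degree-one homogeneous `W`, the
  fixed points of `μ⁻¹W(μ·)`; a decaying one is `W = 0` (`dilationMode_zero`) — the trivial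
  skeleton carries no one-loop data.
* WHY IMPROPER INTEGRALS. PLBL §5 argue that both pairings converge absolutely from decay counts
  (`U† ~ 1/R`, `∇²U_EL ~ 1/R³`, `∂_μU_EL ~ 1/R³`, the last because "the term `1/R` of `μU_EL(μR)`
  is independent of `μ`"). For the invariant family `μ⁻¹W(μ·)` (the skeleton file's design note:
  PLBL print `μU(μR)`) and the tail `W ≈ a(ŷ)/|y|` allowed by the skeleton class
  (`|W| ≲ ⟨y⟩⁻¹`), the dilation mode decays only like `W_d ≈ −2a(ŷ)/|y|`, while the far field of
  the adjoint Euler operator `−(Z + ½ y·∇Z)` (on `ℝ³`) is homogeneous of degree `−2`; so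
  `⟪W_d, Z⟫ ~ |y|⁻³` is in general only CONDITIONALLY convergent (its spherical means cancel by
  Green's identity between the kernel and the adjoint kernel). Requiring Lebesgue integrability
  would risk making `OneLoopData W` empty for the intended `Z` (and every
  `∀ d : OneLoopData W, …` vacuous), so the pairings are improper integrals over the balls
  `‖y‖ ≤ ρ` centred at the similarity origin `y = 0` (the centre singled out by `y·∇`),
  `HasRadialPairing`; they ARE the Lebesgue integrals whenever those converge absolutely
  (`HasRadialPairing.of_integrable`), in particular for `⟨ΔW, Z⟩` (`|y|⁻⁵`).
* The adjoint equation is imposed weakly against smooth compactly supported divergence-free test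
  fields, with `Z ∈ L¹_loc` so that no integral in the structure is a junk `0`; `L_W` is the
  Leray-projected operator on solenoidal fields, whose adjoint kernel consists of solenoidal
  fields, whence the field `isWeaklyDivFree` (it is also what kills `∇P₁` in (self2.5)).
* `‖W‖_∞` is `⨆ y, ‖W y‖` (junk `0` for unbounded `W`, so `κ = 0` then; skeletons are bounded,
  `IsEulerLeraySkeleton.exists_forall_norm_le` in the tree). Division by `⟨W_d, Z⟩` is safe inside the
  structure (`≠ 0`); `radialPairing` alone is `limUnder` (junk if divergent) and is only used
  through `OneLoopData`.
* Rate `½` is hard-wired in `L⁰_W` (Kelvin/Leray exponent `γ = ½`, the route's and PLBL's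
  setting). The file is stated on a finite-dimensional real inner product space `E` with Lebesgue
  measure (`E = ℝ³` in the sources); the scaling bookkeeping above is dimension-free.
* Non-vacuity (scratch, not shipped): on `E = ℝ`, for a bump `W` and `Z = 1` every field of
  `OneLoopData W` is provable (`Z = 1` annihilates `L⁰_W v = ½(v + xv') + (Wv)'` for every test
  `v` by parts, skew endomorphisms of `ℝ` vanish, `⟨W_d, 1⟩ = ∫(xW' − W) = −2∫W ≠ 0`).
* NOT here: the scaling covariance `dμ/ds = νμ³ρ(W)` along the family and the dilation invariance
  `κ(W_λ) = κ(W)` (change of variables in the improper integrals; stated above as motivation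
  only), `L⁰_W W_d = ∇q` for skeletons (needs third derivatives of `W`), and any sign information
  on `κ` (PLBL compute none: "either `μ(τ)` tends to zero … or tends to a non zero fixed point").

## Tree / Mathlib search

Tree: `IsEulerLeraySkeleton`, `eulerLerayDilate`, `eulerLerayDilatePressure`,
`fderiv_eulerLerayDilate(_of_ne_zero)`, `hasDerivAt_eulerLerayDilate_one`,
`IsEulerLeraySkeleton.eulerLerayDilate` (`EulerLeraySkeleton.lean`, the companion request D1: the
dilation family and the skeleton class are NOT redefined here; not imported, see the design
notes); `convect`, `VectorCalculus.IsDivFree`, `IsWeaklyDivFree`,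
`FunctionSpaces.IsTestFunctionOn` (`VectorCalculus.lean`/`SobolevDomain.lean`, reused);
`rotationMode` (`HyperbolicDSSOrbit.lean`: `ℝ³`, vorticity, opposite sign — hence the distinct name
`infinitesimalRotation` on general `E`); `IsLerayProfile ν a` (`SelfSimilar.lean`: `ν = 0`,
`a = ½` is the skeleton equation without decay); `rescaledEulerLerayForce` /
`IsRescaledEulerLeraySolutionOn` (`RescaledEulerLeray.lean`: the time-dependent system with
viscosity `ε`, not needed here); `IsLinearisedMonodromyAt` (`RescaledEulerLerayMonodromy.lean`:
linearisation at a PERIODIC profile in vorticity form — a different object). No dilation mode,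
adjoint zero mode, improper radial pairing or one-loop coefficient
(`lean search 'dilationMode|oneLoopKappa|OneLoopData|radialPairing|infinitesimalRotation'`: none).
Mathlib: `Laplacian` (`Δ`), `MeasureTheory.LocallyIntegrable`, `tendsto_setIntegral_of_monotone`,
`Tendsto.limUnder_eq`, `HasDerivAt.fun_pow/fun_div`, `mul_pos_iff_of_pos_left`.

## References

* Y. Pomeau, M. Le Berre, T. Lehner, *A case of strong nonlinearity: intermittency in highly
  turbulent flows*, C. R. Mécanique 347 (2019) 342–356 = arXiv:1806.04893, §3 eq. (NS-Leray),
  §4 eq. (Euler-Leray1), §5 eqs. (self2.5)–(self2.7) (arXiv pp. 8–10). [PomeauBerreLehner2018]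
* Y. Pomeau, *On the self-similar solution to the Euler equations for an incompressible fluid in
  three dimensions*, C. R. Mécanique 346 (2018) 184–197 (PLBL's [YP]: dilation invariance, `1/R`
  far field; cite-only). [Pomeau2017]
* J. Leray, Acta Math. 63 (1934), §20, (3.11)–(3.12) (similarity variables). [Leray1934]
-/

noncomputable section

open MeasureTheory Set Filter Topology TopologicalSpace Metric
open scoped Laplacian InnerProductSpace RealInnerProductSpace

namespace Literature.Analysis.FluidPDE

/-! ### The dilation mode and the rotation modes (generators of the symmetries) -/

section Modes

variable {E : Type*} [NormedAddCommGroup E] [InnerProductSpace ℝ E]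

/-- The **dilation mode** of a field `W`: `W_d(y) = DW(y)[y] − W(y)`, i.e. `(y·∇)W − W`, the
derivative at `μ = 1` of the dilation family `μ⁻¹W(μ·)` (`hasDerivAt_dilation_dilationMode`; the
family is the tree's `eulerLerayDilate μ W` of `EulerLeraySkeleton.lean`, cf. its
`hasDerivAt_eulerLerayDilate_one`); for a skeleton it spans, with the rotation modes, the
expected kernel of the linearised operator (PLBL §5: "`∂U/∂μ` belongs to the non-empty kernel of
the linear operator `𝓛[U_EL]`"). It is the field paired against the adjoint zero mode on the
left-hand side of PLBL's (self2.6). [cite: PomeauBerreLehner2018, §5 eqs. (self2.5)–(self2.6) (arXiv pp. 8–9)] -/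
def dilationMode (W : E → E) (y : E) : E :=
  fderiv ℝ W y y - W y

/-- Unfolding `dilationMode` (definitional). [cite: PomeauBerreLehner2018, §5 eqs. (self2.5)–(self2.6) (arXiv pp. 8–9)] -/
@[simp]
theorem dilationMode_apply (W : E → E) (y : E) : dilationMode W y = fderiv ℝ W y y - W y := rfl

/-- **The dilation mode generates the dilation family**: `d/dμ|_{μ=1} (μ⁻¹ W(μ y)) = W_d(y)` at
every point where `W` is differentiable (product and chain rule). The family `μ⁻¹ W(μ ·)` is the
tree's `eulerLerayDilate μ W` (`EulerLeraySkeleton.lean`, whose `hasDerivAt_eulerLerayDilate_one` is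
this statement with the derivative spelled `DW(y)[y] − W(y)`); it is written out here so that the
interface does not depend on the skeleton file. [cite: PomeauBerreLehner2018, §5 (arXiv pp. 8–9)] -/
theorem hasDerivAt_dilation_dilationMode {W : E → E} {y : E} (hW : DifferentiableAt ℝ W y) :
    HasDerivAt (fun μ : ℝ => μ⁻¹ • W (μ • y)) (dilationMode W y) 1 := by
  have h1 : HasDerivAt (fun μ : ℝ => μ⁻¹) (-1) 1 := by
    simpa using hasDerivAt_inv (one_ne_zero (α := ℝ))
  have h2 : HasDerivAt (fun μ : ℝ => μ • y) y 1 := by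
    simpa using (hasDerivAt_id (1 : ℝ)).smul_const y
  have hW' : HasFDerivAt W (fderiv ℝ W y) ((fun μ : ℝ => μ • y) 1) := by
    simpa using hW.hasFDerivAt
  have h3 : HasDerivAt (fun μ : ℝ => W (μ • y)) (fderiv ℝ W y y) 1 := hW'.comp_hasDerivAt 1 h2
  have h4 : HasDerivAt (fun μ : ℝ => μ⁻¹ • W (μ • y))
      ((1 : ℝ)⁻¹ • fderiv ℝ W y y + (-1 : ℝ) • W ((1 : ℝ) • y)) 1 := h1.fun_smul h3
  have h5 : (1 : ℝ)⁻¹ • fderiv ℝ W y y + (-1 : ℝ) • W ((1 : ℝ) • y) = dilationMode W y := by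
    rw [dilationMode, inv_one, one_smul, one_smul, neg_one_smul, sub_eq_add_neg]
  rw [h5] at h4
  exact h4

/-- The dilation mode of the zero field vanishes (so the trivial skeleton carries no one-loop
data: transversality `⟨W_d | Z⟩ ≠ 0` fails). [folklore] -/
@[simp]
theorem dilationMode_zero : dilationMode (0 : E → E) = 0 := by
  funext y
  simp [dilationMode, Pi.zero_def]

/-- The **rotation mode** of `W` generated by a (skew) endomorphism `A`:
`d/dθ|_{θ=0} e^{−θA} W(e^{θA} y) = DW(y)[A y] − A (W y)`. Rotations are symmetries of the
Euler–Leray equations preserved by the viscosity (PLBL §5: "a continuous symmetry under rotations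
which is preserved by the viscosity term and so does not bring any dynamics of the parameter
`μ`"), so their modes lie in the kernel of the linearised operator next to the dilation mode, and
the adjoint zero mode dual to the dilation mode must annihilate them
(`OneLoopData.hasRadialPairing_infinitesimalRotation`). (The tree's `rotationMode` of
`HyperbolicDSSOrbit.lean` is the `ℝ³` vorticity version `AΩ − DΩ[A·]`, opposite sign.) [cite: PomeauBerreLehner2018, §5 (arXiv p. 8)] -/
def infinitesimalRotation (A : E →L[ℝ] E) (W : E → E) (y : E) : E :=
  fderiv ℝ W y (A y) - A (W y)

/-- Unfolding `infinitesimalRotation` (definitional). [cite: PomeauBerreLehner2018, §5 (arXiv p. 8)] -/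
@[simp]
theorem infinitesimalRotation_apply (A : E →L[ℝ] E) (W : E → E) (y : E) :
    infinitesimalRotation A W y = fderiv ℝ W y (A y) - A (W y) := rfl

/-- The generator `A = 0` gives the zero mode. [folklore] -/
@[simp]
theorem infinitesimalRotation_zero_left (W : E → E) : infinitesimalRotation 0 W = 0 := by
  funext y
  simp [infinitesimalRotation]

end Modes

/-! ### The linearised similarity-Euler operator (pressure-free part) -/

section Linearised

variable {E : Type*} [NormedAddCommGroup E] [InnerProductSpace ℝ E]

/-- The **linearised similarity-Euler operator** at `W`, pressure-free part:
`L⁰_W v (y) = ½ (v(y) + Dv(y)[y]) + Dv(y)[W(y)] + DW(y)[v(y)]`, i.e.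
`½(v + y·∇v) + (W·∇)v + (v·∇)W` — the derivative at `W` in the direction `v` of the Euler–Leray
nonlinearity `½(U + y·∇U) + U·∇U` (PLBL (Euler-Leray1), (self2.5): "`𝓛` is a linear operator …
derived by linearization of (Euler-Leray1) near the solution `U_EL`"). The route's `L_W` is its
Leray projection `L⁰_W v + ∇q`; the pressure is handled weakly in `OneLoopData` ("we set aside for
the moment the question of the way the pressure enters into this", PLBL §5). [cite: PomeauBerreLehner2018, §5 eq. (self2.5) (arXiv pp. 8–9)] -/
def linearisedSimilarityEuler (W v : E → E) (y : E) : E :=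
  (1 / 2 : ℝ) • (v y + fderiv ℝ v y y) + convect W v y + convect v W y

/-- Unfolding `linearisedSimilarityEuler`: `½(v + Dv[y]) + Dv[W] + DW[v]`. [cite: PomeauBerreLehner2018, §5 eq. (self2.5) (arXiv pp. 8–9)] -/
theorem linearisedSimilarityEuler_apply (W v : E → E) (y : E) :
    linearisedSimilarityEuler W v y =
      (1 / 2 : ℝ) • (v y + fderiv ℝ v y y) + fderiv ℝ v y (W y) + fderiv ℝ W y (v y) := rfl

/-- At `W = 0` the operator is Leray's linear part `½(v + y·∇v)`. [cite: PomeauBerreLehner2018, §5 eq. (self2.5) (arXiv pp. 8–9)] -/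
@[simp]
theorem linearisedSimilarityEuler_zero_left (v : E → E) (y : E) :
    linearisedSimilarityEuler 0 v y = (1 / 2 : ℝ) • (v y + fderiv ℝ v y y) := by
  simp [linearisedSimilarityEuler, convect, Pi.zero_def]

end Linearised

/-! ### The `L²` pairing as an improper integral over centred balls -/

section RadialPairing

variable {E : Type*} [NormedAddCommGroup E] [InnerProductSpace ℝ E] [FiniteDimensional ℝ E]
  [MeasurableSpace E] [BorelSpace E]
variable {F : Type*} [NormedAddCommGroup F] [InnerProductSpace ℝ F]

/-- `HasRadialPairing f g ℓ`: the pairing `⟨f | g⟩ = ∫ f·g` (PLBL (self2.7)) converges to `ℓ`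
as an IMPROPER integral over the balls centred at the similarity origin:
`∫_{‖y‖ ≤ ρ} ⟪f y, g y⟫ dy → ℓ` as `ρ → ∞`. Under absolute convergence this is the Lebesgue
integral (`HasRadialPairing.of_integrable`); it is the honest reading of "this inner product must
be defined by convergent integrals, which requires some care because many functions under
consideration decay slowly at large `R`" (PLBL §5). [cite: PomeauBerreLehner2018, §5 eq. (self2.7) (arXiv p. 9)] -/
def HasRadialPairing (f g : E → F) (ℓ : ℝ) : Prop :=
  Tendsto (fun ρ : ℝ => ∫ y in closedBall (0 : E) ρ, ⟪f y, g y⟫) atTop (𝓝 ℓ)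

/-- The value of the improper pairing `⟨f | g⟩ = lim_{ρ → ∞} ∫_{‖y‖ ≤ ρ} ⟪f, g⟫` (junk —
`limUnder` of a non-convergent net — unless `HasRadialPairing f g ℓ` for some `ℓ`, in which case
it is `ℓ`, `HasRadialPairing.radialPairing_eq`). [cite: PomeauBerreLehner2018, §5 eq. (self2.7) (arXiv p. 9)] -/
def radialPairing (f g : E → F) : ℝ :=
  limUnder atTop (fun ρ : ℝ => ∫ y in closedBall (0 : E) ρ, ⟪f y, g y⟫)

/-- Unfolding `HasRadialPairing`. [cite: PomeauBerreLehner2018, §5 eq. (self2.7) (arXiv p. 9)] -/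
theorem hasRadialPairing_iff (f g : E → F) (ℓ : ℝ) :
    HasRadialPairing f g ℓ ↔
      Tendsto (fun ρ : ℝ => ∫ y in closedBall (0 : E) ρ, ⟪f y, g y⟫) atTop (𝓝 ℓ) := Iff.rfl

/-- The limit of the truncated pairings is unique. [folklore] -/
theorem HasRadialPairing.unique {f g : E → F} {ℓ₁ ℓ₂ : ℝ} (h₁ : HasRadialPairing f g ℓ₁)
    (h₂ : HasRadialPairing f g ℓ₂) : ℓ₁ = ℓ₂ :=
  tendsto_nhds_unique h₁ h₂

/-- A convergent improper pairing has the value `radialPairing`. [folklore] -/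
theorem HasRadialPairing.radialPairing_eq {f g : E → F} {ℓ : ℝ} (h : HasRadialPairing f g ℓ) :
    radialPairing f g = ℓ :=
  h.limUnder_eq

/-- Scaling the second argument: `⟨f | c g⟩ = c ⟨f | g⟩` (no integrability needed). [folklore] -/
theorem HasRadialPairing.smul_right {f g : E → F} {ℓ : ℝ} (h : HasRadialPairing f g ℓ) (c : ℝ) :
    HasRadialPairing f (c • g) (c * ℓ) := by
  have hfun : (fun ρ : ℝ => ∫ y in closedBall (0 : E) ρ, ⟪f y, (c • g) y⟫) =
      fun ρ : ℝ => c * ∫ y in closedBall (0 : E) ρ, ⟪f y, g y⟫ := by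
    funext ρ
    simp only [Pi.smul_apply, real_inner_smul_right]
    exact integral_const_mul c _
  unfold HasRadialPairing
  rw [hfun]
  exact h.const_mul c

/-- The zero field pairs to `0` with everything. [folklore] -/
theorem hasRadialPairing_zero_right (f : E → F) : HasRadialPairing f 0 0 := by
  unfold HasRadialPairing
  simp only [Pi.zero_apply, inner_zero_right, integral_zero]
  exact tendsto_const_nhds

/-- The zero field pairs to `0` with everything (left slot). [folklore] -/
theorem hasRadialPairing_zero_left (g : E → F) : HasRadialPairing 0 g 0 := by
  unfold HasRadialPairing
  simp only [Pi.zero_apply, inner_zero_left, integral_zero]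
  exact tendsto_const_nhds

/-- A pointwise-orthogonal pair has improper pairing `0`. [folklore] -/
theorem hasRadialPairing_of_forall_inner_eq_zero {f g : E → F} (h : ∀ y, ⟪f y, g y⟫ = 0) :
    HasRadialPairing f g 0 := by
  unfold HasRadialPairing
  simp only [h, integral_zero]
  exact tendsto_const_nhds

/-- **Absolute convergence**: if `⟪f, g⟫` is Lebesgue integrable then the improper pairing
converges to the Lebesgue integral `∫ ⟪f y, g y⟫ dy` (monotone convergence over the exhausting
balls, Mathlib's `tendsto_setIntegral_of_monotone`). [folklore] -/
theorem HasRadialPairing.of_integrable {f g : E → F}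
    (h : Integrable (fun y => ⟪f y, g y⟫)) : HasRadialPairing f g (∫ y, ⟪f y, g y⟫) := by
  have hmono : Monotone (fun ρ : ℝ => closedBall (0 : E) ρ) :=
    fun _ _ hρ => closedBall_subset_closedBall hρ
  have hunion : (⋃ ρ : ℝ, closedBall (0 : E) ρ) = univ := by
    refine eq_univ_of_forall fun y => mem_iUnion.2 ⟨‖y‖, ?_⟩
    simp
  have ht := tendsto_setIntegral_of_monotone (μ := volume) (f := fun y => ⟪f y, g y⟫)
    (fun ρ => (isClosed_closedBall (x := (0 : E)) (ε := ρ)).measurableSet) hmono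
    (by rw [hunion]; exact h.integrableOn)
  rw [hunion, setIntegral_univ] at ht
  exact ht

/-- Under absolute convergence `radialPairing f g = ∫ ⟪f y, g y⟫ dy`. [folklore] -/
theorem radialPairing_eq_integral {f g : E → F} (h : Integrable (fun y => ⟪f y, g y⟫)) :
    radialPairing f g = ∫ y, ⟪f y, g y⟫ :=
  (HasRadialPairing.of_integrable h).radialPairing_eq

/-- The improper pairing only depends on the a.e. class of the second slot. [folklore] -/
theorem HasRadialPairing.congr_right {f g₁ g₂ : E → F} {ℓ : ℝ} (hg : g₁ =ᵐ[volume] g₂)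
    (h : HasRadialPairing f g₁ ℓ) : HasRadialPairing f g₂ ℓ := by
  have hfun : (fun ρ : ℝ => ∫ y in closedBall (0 : E) ρ, ⟪f y, g₁ y⟫) =
      fun ρ : ℝ => ∫ y in closedBall (0 : E) ρ, ⟪f y, g₂ y⟫ := by
    funext ρ
    exact integral_congr_ae ((ae_restrict_of_ae hg).mono fun y hy => by
      show ⟪f y, g₁ y⟫ = ⟪f y, g₂ y⟫
      rw [hy])
  unfold HasRadialPairing at h ⊢
  rwa [hfun] at h

/-- `radialPairing f g` only depends on the a.e. class of `g`. [folklore] -/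
theorem radialPairing_congr_right (f : E → F) {g₁ g₂ : E → F} (hg : g₁ =ᵐ[volume] g₂) :
    radialPairing f g₁ = radialPairing f g₂ := by
  have hfun : (fun ρ : ℝ => ∫ y in closedBall (0 : E) ρ, ⟪f y, g₁ y⟫) =
      fun ρ : ℝ => ∫ y in closedBall (0 : E) ρ, ⟪f y, g₂ y⟫ := by
    funext ρ
    exact integral_congr_ae ((ae_restrict_of_ae hg).mono fun y hy => by
      show ⟪f y, g₁ y⟫ = ⟪f y, g₂ y⟫
      rw [hy])
  unfold radialPairing
  rw [hfun]

end RadialPairing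

/-! ### The interface: an adjoint zero mode dual to the dilation mode, and `κ(W)` -/

section OneLoop

variable {E : Type*} [NormedAddCommGroup E] [InnerProductSpace ℝ E] [FiniteDimensional ℝ E]
  [MeasurableSpace E] [BorelSpace E]

/-- **One-loop data at `W`** (interface; PLBL §5): an adjoint zero mode `Z = U†` of the
linearised similarity-Euler operator `L_W`, DUAL TO THE DILATION MODE. Precisely: `Z ∈ L¹_loc`;
`Z` is weakly divergence free (so it annihilates the pressure gradients `∇q` of `L_W v = L⁰_W v + ∇q`
and of (self2.5)); `∫ ⟪L⁰_W v, Z⟫ = 0` for every smooth compactly supported divergence-free `v`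
(the weak form of "`U†` belongs to the kernel of the operator adjoint of `𝓛`", `𝓛† U† = 0`, in
the pairing (self2.7)); the pairings `⟨ΔW | Z⟩` and `⟨∂_μW_μ | Z⟩ = ⟨W_d | Z⟩` of (self2.6)
converge (as improper integrals over centred balls, `HasRadialPairing`), the latter to a NONZERO
value (transversality: otherwise (self2.6) does not determine `dμ/dτ`); and `Z` annihilates every
rotation mode (duality with respect to the other symmetry modes, which "do not bring any dynamics
of the parameter `μ`"). Existence and uniqueness-up-to-scale of such `Z` for an admissible skeleton
`W` are NOT asserted (separate construction statement of the route). [cite: PomeauBerreLehner2018, §5 eqs. (self2.5)–(self2.7) (arXiv pp. 8–9)] -/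
@[ext]
structure OneLoopData (W : E → E) where
  /-- The adjoint zero mode `Z = U†`. -/
  Z : E → E
  /-- `Z` is locally integrable (every pairing below is a genuine integral on bounded sets). -/
  locallyIntegrable : LocallyIntegrable Z
  /-- `Z` is weakly divergence free: `∫ ⟪Z, ∇θ⟫ = 0` for all test functions `θ`. -/
  isWeaklyDivFree : IsWeaklyDivFree Z
  /-- The weak adjoint equation `L_W^* Z = 0`: `Z` annihilates `L⁰_W v` for every smooth,
  compactly supported, divergence-free test field `v`. -/
  integral_inner_linearised_eq_zero : ∀ v : E → E,
    FunctionSpaces.IsTestFunctionOn (⊤ : Opens E) v → VectorCalculus.IsDivFree v →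
      ∫ y, ⟪linearisedSimilarityEuler W v y, Z y⟫ = 0
  /-- The pairing `⟨ΔW | Z⟩` (right-hand side of (self2.6)) converges. -/
  exists_hasRadialPairing_laplacian : ∃ ℓ : ℝ, HasRadialPairing (Δ W) Z ℓ
  /-- The pairing `⟨∂_μW_μ | Z⟩ = ⟨W_d | Z⟩` (left-hand side of (self2.6)) converges to a nonzero
  value. -/
  exists_hasRadialPairing_dilationMode : ∃ ℓ : ℝ, ℓ ≠ 0 ∧ HasRadialPairing (dilationMode W) Z ℓ
  /-- Duality: `Z` annihilates the rotation modes `DW[Ay] − AW`, `A` skew. -/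
  hasRadialPairing_infinitesimalRotation : ∀ A : E →L[ℝ] E, (∀ x y : E, ⟪A x, y⟫ = -⟪x, A y⟫) →
    HasRadialPairing (infinitesimalRotation A W) Z 0

namespace OneLoopData

variable {W : E → E}

/-- The pairing `⟨ΔW | Z⟩` of (self2.6) (viscous defect against the adjoint zero mode). [cite: PomeauBerreLehner2018, §5 eq. (self2.6) (arXiv p. 9)] -/
def laplacianPairing (d : OneLoopData W) : ℝ :=
  radialPairing (Δ W) d.Z

/-- The pairing `⟨∂_μ W_μ | Z⟩ = ⟨W_d | Z⟩` of (self2.6) (dilation mode against the adjoint zero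
mode). [cite: PomeauBerreLehner2018, §5 eq. (self2.6) (arXiv p. 9)] -/
def dilationPairing (d : OneLoopData W) : ℝ :=
  radialPairing (dilationMode W) d.Z

/-- **PLBL's law for the dilation parameter, solved** (eq. (self2.6) at `μ = 1`, per unit
viscosity): `dμ/dτ = ν · dilationDrift`, `dilationDrift = ⟨ΔW | Z⟩ / ⟨W_d | Z⟩` — "a small
viscosity causes a drift of the solution of Euler–Leray equations in the space of the parameter
`μ`". [cite: PomeauBerreLehner2018, §5 eq. (self2.6) (arXiv p. 9)] -/
def dilationDrift (d : OneLoopData W) : ℝ :=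
  d.laplacianPairing / d.dilationPairing

/-- The pairing `⟨ΔW | Z⟩` converges to `d.laplacianPairing`. [cite: PomeauBerreLehner2018, §5 eq. (self2.6) (arXiv p. 9)] -/
theorem hasRadialPairing_laplacianPairing (d : OneLoopData W) :
    HasRadialPairing (Δ W) d.Z d.laplacianPairing := by
  obtain ⟨ℓ, hℓ⟩ := d.exists_hasRadialPairing_laplacian
  rwa [laplacianPairing, hℓ.radialPairing_eq]

/-- The pairing `⟨W_d | Z⟩` converges to `d.dilationPairing`. [cite: PomeauBerreLehner2018, §5 eq. (self2.6) (arXiv p. 9)] -/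
theorem hasRadialPairing_dilationPairing (d : OneLoopData W) :
    HasRadialPairing (dilationMode W) d.Z d.dilationPairing := by
  obtain ⟨ℓ, -, hℓ⟩ := d.exists_hasRadialPairing_dilationMode
  rwa [dilationPairing, hℓ.radialPairing_eq]

/-- Transversality: `⟨W_d | Z⟩ ≠ 0`. [cite: PomeauBerreLehner2018, §5 eq. (self2.6) (arXiv p. 9)] -/
theorem dilationPairing_ne_zero (d : OneLoopData W) : d.dilationPairing ≠ 0 := by
  obtain ⟨ℓ, hℓ0, hℓ⟩ := d.exists_hasRadialPairing_dilationMode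
  rwa [dilationPairing, hℓ.radialPairing_eq]

/-- Unfolding `dilationDrift`. [cite: PomeauBerreLehner2018, §5 eq. (self2.6) (arXiv p. 9)] -/
theorem dilationDrift_def (d : OneLoopData W) :
    d.dilationDrift = d.laplacianPairing / d.dilationPairing := rfl

/-- **Rescaling the adjoint zero mode**: `Z ↦ c Z`, `c ≠ 0`, is again one-loop data (every
condition is linear in `Z`; transversality uses `c ≠ 0`). [cite: PomeauBerreLehner2018, §5 (arXiv p. 9)] -/
def smul (d : OneLoopData W) {c : ℝ} (hc : c ≠ 0) : OneLoopData W where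
  Z := c • d.Z
  locallyIntegrable := d.locallyIntegrable.smul c
  isWeaklyDivFree θ hθ := by
    have h0 := d.isWeaklyDivFree θ hθ
    simp only [Pi.smul_apply, real_inner_smul_left, integral_const_mul, h0, mul_zero]
  integral_inner_linearised_eq_zero v hv hdiv := by
    have h0 := d.integral_inner_linearised_eq_zero v hv hdiv
    simp only [Pi.smul_apply, real_inner_smul_right, integral_const_mul, h0, mul_zero]
  exists_hasRadialPairing_laplacian := by
    obtain ⟨ℓ, hℓ⟩ := d.exists_hasRadialPairing_laplacian
    exact ⟨c * ℓ, hℓ.smul_right c⟩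
  exists_hasRadialPairing_dilationMode := by
    obtain ⟨ℓ, hℓ0, hℓ⟩ := d.exists_hasRadialPairing_dilationMode
    exact ⟨c * ℓ, mul_ne_zero hc hℓ0, hℓ.smul_right c⟩
  hasRadialPairing_infinitesimalRotation A hA := by
    simpa using (d.hasRadialPairing_infinitesimalRotation A hA).smul_right c

/-- The rescaled datum has zero mode `c • Z` (definitional). [folklore] -/
@[simp]
theorem smul_Z (d : OneLoopData W) {c : ℝ} (hc : c ≠ 0) : (d.smul hc).Z = c • d.Z := rfl

/-- `⟨ΔW | cZ⟩ = c ⟨ΔW | Z⟩`. [folklore] -/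
theorem laplacianPairing_smul (d : OneLoopData W) {c : ℝ} (hc : c ≠ 0) :
    (d.smul hc).laplacianPairing = c * d.laplacianPairing :=
  (d.hasRadialPairing_laplacianPairing.smul_right c).radialPairing_eq

/-- `⟨W_d | cZ⟩ = c ⟨W_d | Z⟩`. [folklore] -/
theorem dilationPairing_smul (d : OneLoopData W) {c : ℝ} (hc : c ≠ 0) :
    (d.smul hc).dilationPairing = c * d.dilationPairing :=
  (d.hasRadialPairing_dilationPairing.smul_right c).radialPairing_eq

/-- The drift does not see the normalisation of `Z`. [cite: PomeauBerreLehner2018, §5 eq. (self2.6) (arXiv p. 9)] -/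
theorem dilationDrift_smul (d : OneLoopData W) {c : ℝ} (hc : c ≠ 0) :
    (d.smul hc).dilationDrift = d.dilationDrift := by
  rw [dilationDrift, dilationDrift, laplacianPairing_smul, dilationPairing_smul,
    mul_div_mul_left _ _ hc]

/-- Under absolute convergence of both pairings the drift is the ratio of Lebesgue integrals
`(∫ ⟪ΔW, Z⟫) / (∫ ⟪W_d, Z⟫)` — PLBL's (self2.6) read literally. [cite: PomeauBerreLehner2018, §5 eqs. (self2.6)–(self2.7) (arXiv p. 9)] -/
theorem dilationDrift_eq_integral_div (d : OneLoopData W)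
    (hΔ : Integrable (fun y => ⟪(Δ W) y, d.Z y⟫))
    (hd : Integrable (fun y => ⟪dilationMode W y, d.Z y⟫)) :
    d.dilationDrift = (∫ y, ⟪(Δ W) y, d.Z y⟫) / ∫ y, ⟪dilationMode W y, d.Z y⟫ := by
  rw [dilationDrift, laplacianPairing, dilationPairing, radialPairing_eq_integral hΔ,
    radialPairing_eq_integral hd]

/-- The drift only depends on the a.e. class of `Z` (all conditions are integrals). [cite: PomeauBerreLehner2018, §5 eq. (self2.6) (arXiv p. 9)] -/
theorem dilationDrift_congr_ae {d₁ d₂ : OneLoopData W} (h : d₁.Z =ᵐ[volume] d₂.Z) :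
    d₁.dilationDrift = d₂.dilationDrift := by
  simp only [dilationDrift, laplacianPairing, dilationPairing, radialPairing_congr_right _ h]

end OneLoopData

/-- **The one-loop coefficient `κ(W)`** of the skeleton `W` read through the one-loop data `d`:
`κ = −2 ‖W‖²_∞ · ⟨ΔW | Z⟩ / ⟨W_d | Z⟩`, `‖W‖_∞ = ⨆ y, ‖W y‖`. It is PLBL's dilation law
(self2.6), `dμ/ds = ν ρ(W)` at `μ = 1` (`ρ = d.dilationDrift`), transported along the dilation
family (`dμ/ds = ν μ³ ρ`) and rewritten for the route's running coupling, the local Reynolds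
number `R = (T−t)‖u‖²_∞/ν = ‖W_μ‖²_∞/ν = ‖W‖²_∞/(νμ²)`: `dR/ds = κ(W)`, equivalently
`dε/ds = −κ(W) ε²` for `ε = 1/R` (`hasDerivAt_reynolds_of_dilationDrift`). `κ > 0`: linear creep
`R ≈ κ s`; `κ < 0`: `R` decreases (exit to Type I). Independent of the normalisation of `Z`
(`oneLoopKappa_smul`). [cite: PomeauBerreLehner2018, §5 eq. (self2.6) (arXiv pp. 9–10)] -/
def oneLoopKappa {W : E → E} (d : OneLoopData W) : ℝ :=
  -(2 * (⨆ y, ‖W y‖) ^ 2 * d.dilationDrift)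

/-- Unfolding `oneLoopKappa`. [cite: PomeauBerreLehner2018, §5 eq. (self2.6) (arXiv pp. 9–10)] -/
theorem oneLoopKappa_def {W : E → E} (d : OneLoopData W) :
    oneLoopKappa d = -(2 * (⨆ y, ‖W y‖) ^ 2 * d.dilationDrift) := rfl

/-- `κ` does not depend on the normalisation of the adjoint zero mode. [cite: PomeauBerreLehner2018, §5 eq. (self2.6) (arXiv pp. 9–10)] -/
theorem oneLoopKappa_smul {W : E → E} (d : OneLoopData W) {c : ℝ} (hc : c ≠ 0) :
    oneLoopKappa (d.smul hc) = oneLoopKappa d := by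
  rw [oneLoopKappa, oneLoopKappa, OneLoopData.dilationDrift_smul]

/-- `κ` only depends on the a.e. class of the adjoint zero mode. [cite: PomeauBerreLehner2018, §5 eq. (self2.6) (arXiv pp. 9–10)] -/
theorem oneLoopKappa_congr_ae {W : E → E} {d₁ d₂ : OneLoopData W} (h : d₁.Z =ᵐ[volume] d₂.Z) :
    oneLoopKappa d₁ = oneLoopKappa d₂ := by
  rw [oneLoopKappa, oneLoopKappa, OneLoopData.dilationDrift_congr_ae h]

/-- **Uniqueness up to scale makes `κ(W)` well defined**: if two one-loop data at `W` have
adjoint zero modes agreeing a.e. up to a nonzero constant (the expected conclusion of the route's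
construction statement: a one-dimensional space of adjoint zero modes dual to the dilation mode),
they define the same `κ`. [cite: PomeauBerreLehner2018, §5 eq. (self2.6) (arXiv pp. 9–10)] -/
theorem oneLoopKappa_eq_of_ae_eq_smul {W : E → E} {d₁ d₂ : OneLoopData W} {c : ℝ} (hc : c ≠ 0)
    (h : d₂.Z =ᵐ[volume] c • d₁.Z) : oneLoopKappa d₂ = oneLoopKappa d₁ := by
  rw [← oneLoopKappa_smul d₁ hc]
  exact oneLoopKappa_congr_ae (by simpa using h)

omit [InnerProductSpace ℝ E] [FiniteDimensional ℝ E] [MeasurableSpace E] [BorelSpace E] in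
/-- For a bounded field which is not identically zero, `0 < ‖W‖_∞ = ⨆ y, ‖W y‖`. [folklore] -/
theorem iSup_norm_pos_of_ne_zero {W : E → E} (hW : BddAbove (Set.range fun y => ‖W y‖))
    (hW0 : W ≠ 0) : 0 < ⨆ y, ‖W y‖ := by
  obtain ⟨y, hy⟩ := Function.ne_iff.1 hW0
  have hy' : W y ≠ 0 := hy
  exact (norm_pos_iff.2 hy').trans_le (le_ciSup hW y)

/-- **The sign of `κ`** for a bounded nonzero `W`: `κ(W) < 0 ↔ 0 < ⟨ΔW | Z⟩/⟨W_d | Z⟩`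
(and symmetrically `0 < κ ↔ ρ < 0`): the sign theorem `KappaNegative` of the route is a sign
condition on PLBL's drift. [cite: PomeauBerreLehner2018, §5 eq. (self2.6) (arXiv pp. 9–10)] -/
theorem oneLoopKappa_neg_iff {W : E → E} (d : OneLoopData W)
    (hW : BddAbove (Set.range fun y => ‖W y‖)) (hW0 : W ≠ 0) :
    oneLoopKappa d < 0 ↔ 0 < d.dilationDrift := by
  have hA : 0 < 2 * (⨆ y, ‖W y‖) ^ 2 := mul_pos two_pos (pow_pos (iSup_norm_pos_of_ne_zero hW hW0) 2)
  rw [oneLoopKappa, neg_lt_zero]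
  exact mul_pos_iff_of_pos_left hA

/-- `0 < κ(W) ↔ ⟨ΔW | Z⟩/⟨W_d | Z⟩ < 0` for a bounded nonzero `W`. [cite: PomeauBerreLehner2018, §5 eq. (self2.6) (arXiv pp. 9–10)] -/
theorem oneLoopKappa_pos_iff {W : E → E} (d : OneLoopData W)
    (hW : BddAbove (Set.range fun y => ‖W y‖)) (hW0 : W ≠ 0) :
    0 < oneLoopKappa d ↔ d.dilationDrift < 0 := by
  have hA : 0 < 2 * (⨆ y, ‖W y‖) ^ 2 := mul_pos two_pos (pow_pos (iSup_norm_pos_of_ne_zero hW hW0) 2)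
  rw [oneLoopKappa, neg_pos, ← neg_pos, ← mul_neg, mul_pos_iff_of_pos_left hA, neg_pos]

/-- **From the dilation law to the running coupling** (the normalisation of `κ`): if the dilation
parameter obeys PLBL's law transported along the family, `dμ/ds = ν μ³ ρ`, then the local
Reynolds number `R(s) = A²/(ν μ(s)²)` (`A = ‖W‖_∞`, so that `‖W_μ‖_∞ = A/μ`) obeys
`dR/ds = −2 A² ρ`; with `ρ = d.dilationDrift` and `A = ⨆ y, ‖W y‖` the right-hand side is
`oneLoopKappa d`. Pure calculus (`(μ⁻²)' = −2 μ' μ⁻³`). [cite: PomeauBerreLehner2018, §5 eq. (self2.6) (arXiv pp. 9–10)] -/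
theorem hasDerivAt_reynolds_of_dilationDrift {ν A ρ s : ℝ} {μ : ℝ → ℝ} (hν : ν ≠ 0)
    (hμ : μ s ≠ 0) (hlaw : HasDerivAt μ (ν * μ s ^ 3 * ρ) s) :
    HasDerivAt (fun σ => A ^ 2 / (ν * μ σ ^ 2)) (-(2 * A ^ 2 * ρ)) s := by
  have h1 := (hlaw.fun_pow 2).const_mul ν
  have hne : ν * μ s ^ 2 ≠ 0 := mul_ne_zero hν (pow_ne_zero 2 hμ)
  have h2 := (hasDerivAt_const s (A ^ 2)).fun_div h1 hne
  refine h2.congr_deriv ?_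
  rw [div_eq_iff (pow_ne_zero 2 hne)]
  norm_num
  ring

/-- The same statement with `A = ⨆ y, ‖W y‖` and `ρ = d.dilationDrift`: `dR/ds = oneLoopKappa d`. [cite: PomeauBerreLehner2018, §5 eq. (self2.6) (arXiv pp. 9–10)] -/
theorem hasDerivAt_reynolds_oneLoopKappa {W : E → E} (d : OneLoopData W) {ν s : ℝ} {μ : ℝ → ℝ}
    (hν : ν ≠ 0) (hμ : μ s ≠ 0) (hlaw : HasDerivAt μ (ν * μ s ^ 3 * d.dilationDrift) s) :
    HasDerivAt (fun σ => (⨆ y, ‖W y‖) ^ 2 / (ν * μ σ ^ 2)) (oneLoopKappa d) s :=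
  hasDerivAt_reynolds_of_dilationDrift hν hμ hlaw

end OneLoop

end Literature.Analysis.FluidPDE
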